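import Summits.Langlands.Langlands.Theses.OrdinaryPrimeTransport
import Literature.NumberTheory.Automorphic.WeaklyRegularGaloisRep
import Literature.NumberTheory.Automorphic.QuadraticBaseChangeFrobCompatibleProofs
import Literature.NumberTheory.Automorphic.AutomorphicRepsGLSatakeFlathProofs
import HarnessLib

/-!
# F4 `_onpath` — `Langlands → MultiplicityThreePolarizableSatakeA` (line `MultiplicityThreePolarizableSatakeA`, crux
`ReciprocityUpToIrreducibility`, item stmt-Langlands-14328; G4 ladder-down generation 33)

Every cell of the family is a consequence of the summit: twist the C-algebraic `π` by `|det|^{-(n-1)/2}` to an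
L-algebraic cuspidal `π'` (`CuspidalAutomorphicRepData.exists_twist_hasInfinityType`, Buzzard–Gee §5.3), take
`ρ_{π',ι}` from clause (A) of the summit (for the summit's own `Rec`), read the a.e. Satake half of `Corresponds`,
identify the Satake parameter of `π'` (`HasSatakeParamAt.of_map_mulChar_detTwist_of_cpow` + uniqueness
`hasSatakeParamAt_unique_holds`) and undo the twist inside the Frobenius polynomial
(`arithFrobPolyOfSatake_map_cpow_neg_half`: `arithFrobPolyOfSatake ι q 1 (q^{(n-1)/2}α) = arithFrobPolyOfSatake ι q n α`).
Also `E → rung`.  Sorry-free; `@[aesop safe apply]` on the rung theorem so the kernel's `S → C` closes.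
Definitions verbatim from `Lines/MultiplicityThreePolarizableSatakeA.lean` §1.
-/

noncomputable section

set_option linter.dupNamespace false

open scoped MatrixGroups Matrix NumberField Polynomial Classical
open Filter IsDedekindDomain Field Polynomial NumberField
open Literature.NumberTheory.Automorphic Literature.NumberTheory.GaloisRepresentations
open Literature.NumberTheory.PAdicHodge
open Summit.Langlands

namespace Summit.Langlands.Langlands.Cruxes.ReciprocityUpToIrreducibility.MultiplicityThreePolarizableSatakeA

/-! ## 1. The graded family and the rung -/

/-- **Clause (A), a.e.-Satake form, C-normalisation, for odd polarizable `π` over CM fields whose archimedean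
exponents have multiplicity `≤ m`.**  For `K` CM, `π` cuspidal on `GL_n(𝔸_K)` (`n ≥ 1`) with a C-algebraic
infinity type `T` such that at every complex embedding every exponent `λ_{i,σ}` of the infinitesimal character
occurs with multiplicity `≤ m` (for `m ≤ 2` phrased as Fakhruddin–Pilloni's *weak regularity*), `π^c ≅ π^∨`
(`IsEssConjSelfDual π 1`) and `π` odd (Asai sign `+1`): for every `ℓ`, `ι : ℚ̄_ℓ ≃ ℂ` there is a continuous
`r : Γ_K → GL_n(ℚ̄_ℓ)` which at almost every finite place `v ∤ ℓ` where `π_v` has Satake parameter `α` is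
unramified with `charpoly r(Frob_v) = arithFrobPolyOfSatake ι q_v n α` (the formula of Fakhruddin–Pilloni
Thm. 9.10 / HLTT Thm. A verbatim). [cite: FakhruddinPilloni2021, Thm. 9.10] [cite: Goldring2016, §4.4.1] -/
def PolarizableMultiplicitySatakeA (m : ℕ) : Prop :=
  ∀ (n : ℕ) (K : Type) [Field K] [NumberField K] [IsCMField K]
    (hcpt : isCompact_glFiniteIntegralLevel n K) (π : CuspidalAutomorphicRepData n K hcpt)
    (T : InfinityType K n), 0 < n → π.1.HasInfinityType T → T.IsCAlgebraic →
      (m ≤ 2 → T.IsWeaklyRegular) →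
      (∀ (σ : K →+* ℂ) (a : ℂ), ((T σ).map ArchWeight.a).count a ≤ m) →
      π.1.IsEssConjSelfDual 1 → π.1.HasAsaiSign (NumberField.IsCMField.complexConj K) 1 →
        ∀ (ℓ : ℕ) [Fact ℓ.Prime] (ι : PadicAlgCl ℓ ≃+* ℂ),
          ∃ r : FramedGaloisRep K (PadicAlgCl ℓ) n,
            ∀ᶠ v : HeightOneSpectrum (𝓞 K) in cofinite, ∀ α : Multiset ℂ, π.1.HasSatakeParamAt v α →
              ((ℓ : ℕ) : 𝓞 K) ∉ v.asIdeal →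
                r.IsUnramifiedAt v ∧ r.HasFrobCharpolyAt v (arithFrobPolyOfSatake ι v.residueCard n α)

/-- **THE RUNG** (`m = 3`): the first cell past weak regularity. -/
def MultiplicityThreePolarizableSatakeA : Prop := PolarizableMultiplicitySatakeA 3

/-- The exponent `-(n-1)/2` as a real number. -/
abbrev halfShift (n : ℕ) : ℝ := -(((n : ℝ) - 1) / 2)

/-- `T.twist (-(n-1)/2)` of a C-algebraic `T` is L-algebraic (Buzzard–Gee §5.3). -/
theorem isLAlgebraic_twist_neg_half {K : Type} [Field K] {n : ℕ} {T : InfinityType K n}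
    (hC : T.IsCAlgebraic) : (T.twist ((halfShift n : ℝ) : ℂ)).IsLAlgebraic := by
  have e : ((halfShift n : ℝ) : ℂ) = (((n : ℂ) - 1) / 2) + (((-((n : ℤ) - 1) : ℤ)) : ℂ) := by
    simp only [halfShift]; push_cast; ring
  rw [e, ← InfinityType.twist_twist, InfinityType.isLAlgebraic_twist_intCast_iff]
  exact (InfinityType.isCAlgebraic_iff_isLAlgebraic_twist T).mp hC

/-- **The cell from clause (A) of a reciprocity datum** (the common core of `family_of_top` and of the on-path
theorem `Langlands → rung`): twist `π` by `|det|^{-(n-1)/2}` to an L-algebraic `π'`, take any `ρ` with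
`Corresponds Rec ι π' ρ`, read its a.e. Satake clause and undo the twist on Satake parameters. -/
theorem cell_of_clauseA {n : ℕ} {K : Type} [Field K] [NumberField K] [IsCMField K]
    {hcpt : isCompact_glFiniteIntegralLevel n K} (Rec : ReciprocityData K)
    (hA : ∀ π : CuspidalAutomorphicRepData n K hcpt, π.1.IsLAlgebraic →
      ∀ (ℓ : ℕ) [Fact ℓ.Prime] (ι : PadicAlgCl ℓ ≃+* ℂ),
        ∃ ρ : FramedGaloisRep K (PadicAlgCl ℓ) n, IsGeometricFramed Rec ρ ∧ Corresponds Rec ι π.1 ρ)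
    (π : CuspidalAutomorphicRepData n K hcpt) (T : InfinityType K n) (hn : 0 < n)
    (hT : π.1.HasInfinityType T) (hC : T.IsCAlgebraic) (ℓ : ℕ) [Fact ℓ.Prime] (ι : PadicAlgCl ℓ ≃+* ℂ) :
    ∃ r : FramedGaloisRep K (PadicAlgCl ℓ) n,
      ∀ᶠ v : HeightOneSpectrum (𝓞 K) in cofinite, ∀ α : Multiset ℂ, π.1.HasSatakeParamAt v α →
        ((ℓ : ℕ) : 𝓞 K) ∉ v.asIdeal →
          r.IsUnramifiedAt v ∧ r.HasFrobCharpolyAt v (arithFrobPolyOfSatake ι v.residueCard n α) := by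
  haveI : NeZero n := ⟨hn.ne'⟩
  obtain ⟨χ, π', hχ, hWt, hWt', hT'⟩ := π.exists_twist_hasInfinityType (halfShift n) hT
  have hLalg : π'.1.IsLAlgebraic := ⟨_, hT', isLAlgebraic_twist_neg_half hC⟩
  obtain ⟨ρ, -, hcorr⟩ := hA π' hLalg ℓ ι
  refine ⟨ρ, ?_⟩
  filter_upwards [hcorr.1] with v hv α hα _hℓ
  obtain ⟨α', hα', hur, hch⟩ := hv
  refine ⟨hur, ?_⟩
  have hq : 0 < v.residueCard := Nat.zero_lt_of_lt v.one_lt_residueCard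
  have hqC : (v.residueCard : ℂ) ≠ 0 := by exact_mod_cast hq.ne'
  have hα'' : π'.1.HasSatakeParamAt v
      (α.map (((v.residueCard : ℂ) ^ (-((halfShift n : ℝ) : ℂ))) * ·)) :=
    AutomorphicRepData.HasSatakeParamAt.of_map_mulChar_detTwist_of_cpow hχ hWt hWt' hα
  have heq : α' = α.map (((v.residueCard : ℂ) ^ (-((halfShift n : ℝ) : ℂ))) * ·) :=
    AutomorphicRepData.hasSatakeParamAt_unique_holds π'.1 hα' hα''
  have hmap : α'.map (((v.residueCard : ℂ) ^ (-((((n : ℝ) - 1) / 2 : ℝ) : ℂ))) * ·) = α := by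
    rw [heq, Multiset.map_map]
    conv_rhs => rw [← Multiset.map_id α]
    refine Multiset.map_congr rfl fun a _ => ?_
    simp only [Function.comp_apply, id, halfShift, Complex.ofReal_neg, neg_neg]
    rw [← mul_assoc, ← Complex.cpow_add _ _ hqC, neg_add_cancel, Complex.cpow_zero, one_mul]
  have key := arithFrobPolyOfSatake_map_cpow_neg_half ι hq (Nat.one_le_iff_ne_zero.mpr hn.ne') α'
  rw [hmap] at key
  rwa [← key] at hch

/-- `E → PolarizableMultiplicitySatakeA m` for every `m` (clause (A) of E for its own `Rec`). -/
theorem family_of_top (m : ℕ)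
    (hE : Summit.Langlands.Langlands.Theses.OrdinaryPrimeTransport.ReciprocityUpToIrreducibility) :
    PolarizableMultiplicitySatakeA m := by
  intro n K _ _ _ hcpt π T hn hT hC _hW _hmult _hsd _hodd ℓ _ ι
  obtain ⟨Rec, hall⟩ := hE K
  exact cell_of_clauseA Rec (hall n hn hcpt).1 π T hn hT hC ℓ ι

/-- `E → rung`. -/
theorem MultiplicityThreePolarizableSatakeA_of_top
    (hE : Summit.Langlands.Langlands.Theses.OrdinaryPrimeTransport.ReciprocityUpToIrreducibility) :
    MultiplicityThreePolarizableSatakeA :=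
  family_of_top 3 hE


/-- **`Langlands → PolarizableMultiplicitySatakeA m`** for every `m` (clause (A) of the summit for its own `Rec`). -/
theorem family_of_langlands (m : ℕ) (hL : _root_.Langlands) : PolarizableMultiplicitySatakeA m := by
  intro n K _ _ _ hcpt π T hn hT hC _hW _hmult _hsd _hodd ℓ _ ι
  obtain ⟨⟨Rec⟩, hall⟩ := hL K
  have hA : AutomorphicToGalois n Rec hcpt := (hall Rec n hn hcpt).1
  exact cell_of_clauseA Rec (fun π' hL' ℓ' _ ι' => by
    obtain ⟨ρ, -, hgeo, hcorr, -⟩ := hA π' hL' ℓ' ι'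
    exact ⟨ρ, hgeo, hcorr⟩) π T hn hT hC ℓ ι

/-- **ON-PATH: `Langlands → THE RUNG`.** -/
@[aesop safe apply]
theorem MultiplicityThreePolarizableSatakeA_of_Langlands (hL : _root_.Langlands) :
    MultiplicityThreePolarizableSatakeA :=
  family_of_langlands 3 hL

end Summit.Langlands.Langlands.Cruxes.ReciprocityUpToIrreducibility.MultiplicityThreePolarizableSatakeA

end
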